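import Summits.NavierStokesRegularity.NavierStokesRegularity.Theorems.StrainDoorsNearRecordGradientRate
import HarnessLib

/-!
# StrainDoorsNearRecordFlatness — PART M §M15: SECOND-ORDER FLATNESS OF THE VORTICITY NUMBER AT A NEAR-RECORD

nsreg-p1 g36, ROUND-64 (helper lane of `stmt-NavierStokesRegularity-0056`, rung N0; 0 ledger writes by the
planner — text for the S-lane to land `--supports stmt-NavierStokesRegularity-0056 --as helper`; tree file 3 of 4
of ROUND-64; bodies farm-certified inside `r64/StrainDoorsR64All.lean`, rc 0 · 0 warn · 0 sorry, std axioms).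

ROUND 63 §M10 transferred a `δ`-near-record to the parabolic ball of radius `r√(0 − t)` with the FIRST-ORDER
loss `δ + K·r`.  The near-record gradient law with a rate (§M7, `norm_fderiv_le_two_sqrt_of_le` applied to
`f = |ω'(−1,·)|²`, gradient `L`-Lipschitz) and the one-sided Taylor bound `taylor_quadratic_of_fderiv_lipschitz`
give the SECOND-ORDER version:

* ★★ `typeI_nearRecord_secondOrder_flatness` — `((0 − t)|ω(t,x)|)² − √(A·W·δ)·ρ − L·ρ² ≤ ((0 − t)|ω(t,y)|)²`
  for every `y`, `ρ = |y − x|/√(0 − t)` (instant domination `(0 − t)|ω(t,·)| ≤ W`, `W − δ ≤ (0 − t)|ω(t,x)|`).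

So a `δ`-near-record carries `(δ + η)`-near-records (in the squared vorticity number) on a parabolic ball of radius
`~√(η/L)` once `√(AWδ) ≲ √(ηL)·…` — quadratically larger than §M10's `η/K`.  [new-as-typed]
-/

noncomputable section

open MeasureTheory Set Function Filter Metric Real InnerProductSpace
open _root_.Topology
open scoped ENNReal NNReal RealInnerProductSpace ContDiff Laplacian
open Literature.Analysis Literature.Analysis.FluidPDE
open Literature.Analysis.FluidPDE.VorticityDirectionDynamics

set_option linter.dupNamespace false
set_option maxSynthPendingDepth 3

namespace Summit.NavierStokesRegularity.NavierStokesRegularity.Theorems.StrainDoors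

open Summit.NavierStokesRegularity.NavierStokesRegularity.Theorems.ArgmaxDoors


/-! ## §M15 Second-order flatness of the vorticity number around a near-record

ROUND 63 §M10 transferred near-records to parabolic balls with a FIRST-ORDER loss `δ + K·r`; the gradient law
§M7 upgrades this to second order: the loss is `O(√δ·r + r²)`, so a `δ`-near-record carries a parabolic ball of
radius `~√η` (not `~η`) of `(δ + η)`-near-records (in the squared vorticity number). -/

/-- ★★ **SECOND-ORDER FLATNESS OF THE SCALE-INVARIANT VORTICITY AROUND A NEAR-RECORD.**  For every `C₀ ≥ 0`
there are `A, L ≥ 0` (depending on `C₀` only; `L` the scale-free Lipschitz constant of `∇|ω'|²` at time `−1`,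
`A = 8L`) such that for every classical Type-I ancient solution, `t < 0`, a point `x` whose scale-invariant
vorticity `(0 − t)|ω(t,x)| ≥ W − δ` while `(0 − t)|ω(t,y')| ≤ W` for all `y'` (instant domination), and EVERY `y`,
with the parabolic distance `ρ = |y − x|/√(0 − t)`:
`((0 − t)|ω(t,x)|)² − √(A·W·δ)·ρ − L·ρ² ≤ ((0 − t)|ω(t,y)|)²`.
One-sided Taylor bound of `f = |ω'(−1,·)|²` (gradient `L`-Lipschitz, `taylor_quadratic_of_fderiv_lipschitz`) and
the near-record gradient law `|∇f(z)| ≤ 2√(2WδL)` (§M7). [new-as-typed] -/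
theorem typeI_nearRecord_secondOrder_flatness {C₀ : ℝ} (hC₀ : 0 ≤ C₀) :
    ∃ A L : ℝ, 0 ≤ A ∧ 0 ≤ L ∧
      ∀ (u : ℝ → (EuclideanSpace ℝ (Fin 3)) → (EuclideanSpace ℝ (Fin 3))) (p : ℝ → (EuclideanSpace ℝ (Fin 3)) → ℝ)
        (W t δ : ℝ) (x y : EuclideanSpace ℝ (Fin 3)),
        IsClassicalNSSolutionOn (Iio 0) 1 0 u p → HasTypeIDecay C₀ u → t < 0 →
        (∀ y', (0 - t) * ‖curl (u t) y'‖ ≤ W) → 0 ≤ δ → W - δ ≤ (0 - t) * ‖curl (u t) x‖ →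
        ((0 - t) * ‖curl (u t) x‖) ^ 2 - √(A * W * δ) * (‖y - x‖ / √(0 - t)) - L * (‖y - x‖ / √(0 - t)) ^ 2 ≤
          ((0 - t) * ‖curl (u t) y‖) ^ 2 := by
  obtain ⟨B, hB, hBb⟩ := typeI_vorticityNumber_bound hC₀
  obtain ⟨K₂, L₁, hK₂, hL₁, hG⟩ := exists_uniform_gradLipschitz hC₀
  obtain ⟨K₂', K₃', hK₂', hK₃', hH⟩ := exists_uniform_hessLipschitz hC₀
  obtain ⟨c, hc⟩ : ∃ c : ℝ, c = ‖(curlCLM : ((EuclideanSpace ℝ (Fin 3)) →L[ℝ] (EuclideanSpace ℝ (Fin 3))) →L[ℝ]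
      (EuclideanSpace ℝ (Fin 3)))‖ := ⟨_, rfl⟩
  have hc0 : 0 ≤ c := by rw [hc]; exact norm_nonneg _
  obtain ⟨L, hLdef⟩ : ∃ L : ℝ, L = 2 * ((c * K₂) * (c * K₂') + B * (c * K₃')) := ⟨_, rfl⟩
  have hL0 : 0 ≤ L := by rw [hLdef]; positivity
  refine ⟨8 * L, L, by positivity, hL0, fun u p W t δ x y hsol hI ht hdom hδ hnear => ?_⟩
  have h14 : (-1 : ℝ) ≤ -(1 / 4 : ℝ) := by norm_num
  -- rescale to time `-1`
  obtain ⟨lam, hlam⟩ : ∃ lam : ℝ, lam = √(0 - t) := ⟨_, rfl⟩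
  have hlam0 : 0 < lam := by rw [hlam]; exact Real.sqrt_pos.mpr (by linarith)
  have hlam2 : lam ^ 2 = 0 - t := by rw [hlam]; exact Real.sq_sqrt (by linarith)
  have ht1 : lam ^ 2 * (-1) = t := by rw [hlam2]; ring
  obtain ⟨z, hz⟩ : ∃ z : EuclideanSpace ℝ (Fin 3), z = lam⁻¹ • x := ⟨_, rfl⟩
  have hxz : lam • z = x := by rw [hz]; exact smul_inv_smul₀ hlam0.ne' _
  have hcl := (typeI_class_nsRescale hlam0 hsol hI).1
  have hI' := (typeI_class_nsRescale hlam0 hsol hI).2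
  -- the data at time `-1`: `w = ω'(-1,·)`, `Dw = curlCLM ∘ D²u'(-1,·)`, and their uniform bounds
  obtain ⟨w, hw⟩ : ∃ w : (EuclideanSpace ℝ (Fin 3)) → (EuclideanSpace ℝ (Fin 3)),
      w = curl (nsRescale lam u (-1)) := ⟨_, rfl⟩
  obtain ⟨Dw, hDw⟩ : ∃ Dw : (EuclideanSpace ℝ (Fin 3)) → ((EuclideanSpace ℝ (Fin 3)) →L[ℝ]
      (EuclideanSpace ℝ (Fin 3))),
      Dw = fun y => curlCLM.comp (fderiv ℝ (fderiv ℝ (nsRescale lam u (-1))) y) := ⟨_, rfl⟩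
  have hWdom : ∀ y, ‖w y‖ ≤ W := fun y => by
    have h := hdom (lam • y)
    rw [← ht1, ← vorticityNumber_nsRescale] at h
    norm_num at h
    rw [hw]
    exact h
  have hnear' : W - δ ≤ ‖w z‖ := by
    have h := hnear
    rw [← hxz, ← ht1, ← vorticityNumber_nsRescale] at h
    norm_num at h
    rw [hw]
    linarith
  have hwB : ∀ y, ‖w y‖ ≤ B := fun y => by
    have h := hBb hcl hI' (-1) (by norm_num) y
    norm_num at h
    rw [hw]
    exact h
  have hHd : ∀ y, HasFDerivAt (fderiv ℝ (nsRescale lam u (-1)))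
      (fderiv ℝ (fderiv ℝ (nsRescale lam u (-1))) y) y := fun y =>
    ((((hcl.contDiff_velocity (show (-1 : ℝ) ∈ Iio 0 by norm_num)).fderiv_right (m := 1)
      (by norm_cast)).differentiable (by norm_cast)) y).hasFDerivAt
  have hwd : ∀ y, HasFDerivAt w (Dw y) y := fun y => by
    rw [hw, hDw]
    exact hasFDerivAt_curl_of_hasFDerivAt_fderiv (hHd y)
  have hDwB : ∀ y, ‖Dw y‖ ≤ c * K₂' := fun y => by
    rw [hDw, hc]
    exact (ContinuousLinearMap.opNorm_comp_le _ _).trans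
      (mul_le_mul_of_nonneg_left ((hH hcl hI').1 (-1) h14 y) (norm_nonneg _))
  have hDwL : ∀ a b, ‖Dw a - Dw b‖ ≤ c * K₃' * ‖a - b‖ := fun a b => by
    rw [hDw, hc]
    dsimp only
    rw [← ContinuousLinearMap.comp_sub, mul_assoc]
    exact (ContinuousLinearMap.opNorm_comp_le _ _).trans
      (mul_le_mul_of_nonneg_left ((hH hcl hI').2 (-1) h14 a b) (norm_nonneg _))
  have hwL : ∀ a b, ‖w a - w b‖ ≤ c * K₂ * ‖a - b‖ := fun a b => by
    rw [hw, hc]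
    exact curl_sub_le_of_fderiv_lipschitz ((hG hcl hI').1 (-1) h14) a b
  -- `f = |w|²` and its derivative `f' y = 2 (innerSL (w y)) ∘ Dw y`, `L`-Lipschitz
  obtain ⟨f, hf⟩ : ∃ f : (EuclideanSpace ℝ (Fin 3)) → ℝ, f = fun y => ‖w y‖ ^ 2 := ⟨_, rfl⟩
  obtain ⟨f', hf'⟩ : ∃ f' : (EuclideanSpace ℝ (Fin 3)) → ((EuclideanSpace ℝ (Fin 3)) →L[ℝ] ℝ),
      f' = fun y => (2 : ℝ) • (innerSL ℝ (w y)).comp (Dw y) := ⟨_, rfl⟩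
  have hfd' : ∀ y, HasFDerivAt f (f' y) y := fun y => by
    rw [hf, hf']
    exact (hwd y).norm_sq.congr_fderiv (by simp only [two_smul])
  have hfd : Differentiable ℝ f := fun y => (hfd' y).differentiableAt
  have hff' : ∀ y, fderiv ℝ f y = f' y := fun y => (hfd' y).fderiv
  have hfL : ∀ a b, ‖fderiv ℝ f a - fderiv ℝ f b‖ ≤ L * ‖a - b‖ := fun a b => by
    rw [hff', hff', hf']
    dsimp only
    have e : (innerSL ℝ (w a)).comp (Dw a) - (innerSL ℝ (w b)).comp (Dw b) =
        (innerSL ℝ (w a - w b)).comp (Dw a) + (innerSL ℝ (w b)).comp (Dw a - Dw b) := by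
      rw [map_sub, ContinuousLinearMap.sub_comp, ContinuousLinearMap.comp_sub]
      abel
    rw [← smul_sub, norm_smul, Real.norm_of_nonneg zero_le_two, e, hLdef]
    have h1 : ‖(innerSL ℝ (w a - w b)).comp (Dw a)‖ ≤ (c * K₂ * ‖a - b‖) * (c * K₂') :=
      (ContinuousLinearMap.opNorm_comp_le _ _).trans (by
        rw [innerSL_apply_norm]
        exact mul_le_mul (hwL a b) (hDwB a) (norm_nonneg _) (by positivity))
    have h2 : ‖(innerSL ℝ (w b)).comp (Dw a - Dw b)‖ ≤ B * (c * K₃' * ‖a - b‖) :=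
      (ContinuousLinearMap.opNorm_comp_le _ _).trans (by
        rw [innerSL_apply_norm]
        exact mul_le_mul (hwB b) (hDwL a b) (norm_nonneg _) hB)
    have h3 := norm_add_le ((innerSL ℝ (w a - w b)).comp (Dw a)) ((innerSL ℝ (w b)).comp (Dw a - Dw b))
    have h4 : 0 ≤ ‖a - b‖ := norm_nonneg _
    nlinarith
  -- Fermat with a rate for `f ≤ W²`, and the deficit `W² − f(z) ≤ 2Wδ`
  have hfM : ∀ y, f y ≤ W ^ 2 := fun y => by
    rw [hf]
    exact pow_le_pow_left₀ (norm_nonneg _) (hWdom y) 2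
  have hF := norm_fderiv_le_two_sqrt_of_le hfd hL0 hfL hfM z
  have hW0 : 0 ≤ W := (norm_nonneg _).trans (hWdom z)
  have hdef : W ^ 2 - f z ≤ 2 * W * δ := by
    rw [hf]
    dsimp only
    have e1 : W ^ 2 - ‖w z‖ ^ 2 = (W - ‖w z‖) * (W + ‖w z‖) := by ring
    have e2 : (W - ‖w z‖) * (W + ‖w z‖) ≤ δ * (W + ‖w z‖) :=
      mul_le_mul_of_nonneg_right (by linarith) (by positivity)
    have e3 : δ * (W + ‖w z‖) ≤ δ * (2 * W) := mul_le_mul_of_nonneg_left (by linarith [hWdom z]) hδ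
    linarith
  have hF' : ‖f' z‖ ≤ 2 * √(2 * W * δ * L) := by
    rw [← hff']
    exact hF.trans (mul_le_mul_of_nonneg_left
      (Real.sqrt_le_sqrt (mul_le_mul_of_nonneg_right hdef hL0)) zero_le_two)

  -- the second point, Taylor, and the scale identities
  obtain ⟨z', hz'⟩ : ∃ z' : EuclideanSpace ℝ (Fin 3), z' = lam⁻¹ • y := ⟨_, rfl⟩
  have hyz : lam • z' = y := by rw [hz']; exact smul_inv_smul₀ hlam0.ne' _
  have hzz : ‖z' - z‖ = ‖y - x‖ / √(0 - t) := by
    rw [← hlam, hz, hz', ← smul_sub, norm_smul, norm_inv, Real.norm_of_nonneg hlam0.le]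
    field_simp
  have hnx : ((0 - t) * ‖curl (u t) x‖) ^ 2 = f z := by
    rw [hf]; dsimp only
    conv_lhs => rw [← hxz, ← ht1]
    rw [← vorticityNumber_nsRescale, hw]
    norm_num
  have hny : ((0 - t) * ‖curl (u t) y‖) ^ 2 = f z' := by
    rw [hf]; dsimp only
    conv_lhs => rw [← hyz, ← ht1]
    rw [← vorticityNumber_nsRescale, hw]
    norm_num
  have hT := taylor_quadratic_of_fderiv_lipschitz hfd hL0 hfL z (z' - z)
  rw [add_sub_cancel, Real.norm_eq_abs] at hT
  have hT1 := (abs_le.1 hT).1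
  have hlin : -(‖f' z‖ * ‖z' - z‖) ≤ fderiv ℝ f z (z' - z) := by
    rw [hff']
    have h := (abs_le.1 (Real.norm_eq_abs _ ▸ (f' z).le_opNorm (z' - z))).1
    linarith
  have hsq : √(8 * L * W * δ) = 2 * √(2 * W * δ * L) := by
    rw [show 8 * L * W * δ = 2 ^ 2 * (2 * W * δ * L) by ring, Real.sqrt_mul (by norm_num), Real.sqrt_sq zero_le_two]
  rw [hnx, hny, ← hzz, hsq]
  have hρ0 : 0 ≤ ‖z' - z‖ := norm_nonneg _
  have hF2 : ‖f' z‖ * ‖z' - z‖ ≤ 2 * √(2 * W * δ * L) * ‖z' - z‖ := mul_le_mul_of_nonneg_right hF' hρ0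
  nlinarith [hT1, hlin, hF2]

end Summit.NavierStokesRegularity.NavierStokesRegularity.Theorems.StrainDoors
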